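import Mathlib
import HarnessLib
import Literature.Analysis.FluidPDE.SelfSimilar

/-!
# Route LocalLevelHeadDoor · crux `LevelHeadProfileRigidity` (stmt-NavierStokesRegularity-28095) · LINE g6-2 —
# the rung `clockExtinction` (= registered stub `stub_clockExtinction`, PROVED by the planner)

Text VERBATIM from ns-idea-6 g6's HOME rung `lines/LocalLevelHeadDoor/LevelHead_rung.lean` (BC5 rung, farm-checked by the
planner; a planner cannot write under `Theorems/`), landed by ns-sz-p1 g5 on director-ns DIRECTOR-NS #237 (2),
`--supports stmt-NavierStokesRegularity-28095 --as helper`.  CONTENT: an ancient field with Type-I time rate whose speed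
at every point is non-increasing in time vanishes identically (the clock `C/√(−t) → 0` as `t → −∞`).

HONEST FRAMING: elementary; nothing here bears on the door's Target, 0056 or Navier–Stokes regularity.
-/

noncomputable section

set_option linter.dupNamespace false

namespace Summit.NavierStokesRegularity.NavierStokesRegularity.Cruxes.LevelHeadProfileRigidity.PointwiseClock
open scoped BigOperators Topology Classical InnerProductSpace RealInnerProductSpace
open Filter Set Function
open Literature.Analysis.FluidPDE

/-- **Clock extinction (PROVED stub)**: an ancient field with Type-I rate whose speed at every point is non-increasing in time
vanishes identically. -/
theorem clockExtinction : ∀ (C : ℝ) (v : ℝ → EuclideanSpace ℝ (Fin 3) → EuclideanSpace ℝ (Fin 3)), Literature.Analysis.FluidPDE.HasTypeITimeDecay C v → (∀ x : EuclideanSpace ℝ (Fin 3), ∀ t₀ t₁ : ℝ, t₀ < t₁ → t₁ < 0 → ‖v t₁ x‖ ≤ ‖v t₀ x‖) → ∀ t < 0, ∀ x : EuclideanSpace ℝ (Fin 3), v t x = 0 := by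
  intro C v hrate hmono t ht x
  by_contra hne
  have ha : 0 < ‖v t x‖ := norm_pos_iff.2 hne
  set a : ℝ := ‖v t x‖ with ha_def
  set t₀ : ℝ := min (t - 1) (-((C / a) ^ 2 + 1)) with ht₀
  have ht₀t : t₀ < t := lt_of_le_of_lt (min_le_left _ _) (by linarith)
  have ht₀neg : (C / a) ^ 2 + 1 ≤ -t₀ := by
    have := min_le_right (t - 1) (-((C / a) ^ 2 + 1))
    linarith
  have hnt₀ : 0 < -t₀ := by linarith [sq_nonneg (C / a)]
  have h1 := hmono x t₀ t ht₀t ht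
  have h2 := hrate t₀ (by linarith) x
  have hspos : 0 < Real.sqrt (-t₀) := Real.sqrt_pos.2 hnt₀
  have hs : C / a < Real.sqrt (-t₀) := by
    have hlt : (C / a) ^ 2 < -t₀ := by linarith
    calc C / a ≤ |C / a| := le_abs_self _
      _ = Real.sqrt ((C / a) ^ 2) := (Real.sqrt_sq_eq_abs _).symm
      _ < Real.sqrt (-t₀) := Real.sqrt_lt_sqrt (sq_nonneg _) hlt
  have h3 : C / Real.sqrt (-t₀) < a := by
    rw [div_lt_iff₀ hspos]
    have h4 := (div_lt_iff₀ ha).1 hs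
    linarith [mul_comm (Real.sqrt (-t₀)) a]
  linarith

/-- Alias under the skeleton's stub name (`StubClockExtinction` verbatim). [folklore] -/
theorem stub_clockExtinction : ∀ (C : ℝ) (v : ℝ → EuclideanSpace ℝ (Fin 3) → EuclideanSpace ℝ (Fin 3)), Literature.Analysis.FluidPDE.HasTypeITimeDecay C v → (∀ x : EuclideanSpace ℝ (Fin 3), ∀ t₀ t₁ : ℝ, t₀ < t₁ → t₁ < 0 → ‖v t₁ x‖ ≤ ‖v t₀ x‖) → ∀ t < 0, ∀ x : EuclideanSpace ℝ (Fin 3), v t x = 0 :=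
  clockExtinction

end Summit.NavierStokesRegularity.NavierStokesRegularity.Cruxes.LevelHeadProfileRigidity.PointwiseClock

end
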